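/-
  C-fs (gen-39 by-product of fwd-ladder SblfExists) — the MOD-2 SHADOW of genus-2 Hurwitz cycle systems.

  `V = H₁(Σ₂; 𝔽₂)` with its intersection form `ω`.  Under Birman–Hilden, `Sp(4,𝔽₂) ≅ S₆`: non-zero classes ↔
  2-subsets of the six branch points, transvections ↔ transpositions, `ω(h,h') = 1` ↔ the 2-subsets share exactly
  one point.  A Hurwitz cycle system `(c; c₁, c₂, c₃, c₄)` of a genus-2 SBLF has the shadow `(⟦c⟧; ⟦c₁⟧, …, ⟦c₄⟧)`;
  elementary transformations act by mod-2 Picard–Lefschetz transvections, simultaneous actions by `Sp(4,𝔽₂)`.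

  Kernel-checked here (pure linear algebra over 𝔽₂, no topology):
  * `allOrthogonal_iff_move`, `allOrthogonal_iff_map`, `allOrthogonal_iff_of_equiv` — "all Lefschetz classes pairwise
    ω-orthogonal" is an invariant of the equivalence class of the shadow;
  * `flipType_shape_a`, `flipType_shape_d` — the two shapes of an UN-FLIP-AND-SLIP position (Hayano arXiv:1203.4299
    Thm 5.1(1) + sink rule, boundary monodromy trivial, `α' = φ⁻¹(α̃)` with `π_φ ∈ {1, (pq)(st)(uw)}`) are `FlipType`,
    hence all-orthogonal (`allOrthogonal_of_flipType`);
  * `oddPair_of_cusps` — the three Lefschetz classes unsunk from an empty 3-cusped circle (UN-WRINKLE position,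
    card unwrinkle-to-matsumoto K1 (i)+(ii)) contain an ω-odd pair;
  * `not_oddPair_of_equiv_flipType` — DICHOTOMY: no system equivalent to an un-flip position has an odd pair; so no
    Hurwitz class is both un-flippable and un-wrinklable;
  * the shadows of the g38 census representatives and of the two known S⁴ systems, sorted (examples at the end).
  The topological inputs (which positions have which shadows) are proved on paper in C-fs-mod2-sorting-g39.md §2–§3.
-/
import Mathlib.Data.ZMod.Basic
import Mathlib.Data.Fin.VecNotation
import Mathlib.Data.Fintype.Pi
import Mathlib.Algebra.Module.Pi
import Mathlib.Tactic

namespace Summit.SmoothPoincare4.SmoothPoincare4.Cruxes.StepTwo.Mod2Sorting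

/-- `H₁(Σ₂; 𝔽₂)` in a symplectic basis `(a₁, b₁, a₂, b₂)`. -/
abbrev V := Fin 4 → ZMod 2

/-- The mod-2 intersection form. -/
def ω (x y : V) : ZMod 2 := x 0 * y 1 + x 1 * y 0 + x 2 * y 3 + x 3 * y 2

/-- Mod-2 Picard–Lefschetz: `t_a^{±1}` acts on `H₁(Σ₂;𝔽₂)` by `x ↦ x + ω(a,x)·a`. -/
def transvection (a x : V) : V := x + ω a x • a

theorem ω_self (x : V) : ω x x = 0 := by
  revert x; decide

theorem ω_comm (x y : V) : ω x y = ω y x := by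
  unfold ω; ring

theorem ω_add_left (x y z : V) : ω (x + y) z = ω x z + ω y z := by
  unfold ω; simp only [Pi.add_apply]; ring

theorem ω_add_right (x y z : V) : ω x (y + z) = ω x y + ω x z := by
  unfold ω; simp only [Pi.add_apply]; ring

theorem ω_smul_right (x y : V) (t : ZMod 2) : ω x (t • y) = t * ω x y := by
  unfold ω; simp only [Pi.smul_apply, smul_eq_mul]; ring

theorem ω_smul_left (x y : V) (t : ZMod 2) : ω (t • x) y = t * ω x y := by
  unfold ω; simp only [Pi.smul_apply, smul_eq_mul]; ring

theorem add_self (x : V) : x + x = 0 := by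
  funext k
  simp only [Pi.add_apply, Pi.zero_apply]
  generalize x k = t; revert t; decide

/-- The mod-2 shadow of a genus-2 Hurwitz cycle system `(c; c₁, c₂, c₃, c₄)`. -/
structure Shadow where
  c : V
  cs : Fin 4 → V

/-- Elementary transformation at position `i`: `(cᵢ, cᵢ₊₁) ↦ (cᵢ₊₁, t_{cᵢ₊₁}(cᵢ))` (Baykur–Hayano Def. 3.5),
read mod 2. -/
def move (i : Fin 3) (W : Shadow) : Shadow where
  c := W.c
  cs := fun j =>
    if j = i.castSucc then W.cs i.succ
    else if j = i.succ then transvection (W.cs i.succ) (W.cs i.castSucc)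
    else W.cs j

/-- Simultaneous action by a mapping class, read mod 2: an `ω`-preserving map applied to every curve. -/
def Shadow.map (g : V → V) (W : Shadow) : Shadow := ⟨g W.c, fun i => g (W.cs i)⟩

/-- Mod-2 Hurwitz equivalence of shadows: closure under elementary transformations, their inverses and
simultaneous `ω`-preserving actions. -/
inductive Equiv : Shadow → Shadow → Prop
  | refl (W) : Equiv W W
  | symm {W W'} : Equiv W W' → Equiv W' W
  | trans {W W' W''} : Equiv W W' → Equiv W' W'' → Equiv W W''
  | move (i : Fin 3) (W) : Equiv W (move i W)
  | map (g : V → V) (hg : ∀ x y, ω (g x) (g y) = ω x y) (W) : Equiv W (W.map g)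

/-- All Lefschetz classes pairwise `ω`-orthogonal (under BH: no two Lefschetz arcs share exactly one endpoint). -/
def AllOrthogonal (W : Shadow) : Prop := ∀ i j, ω (W.cs i) (W.cs j) = 0

/-- Some pair of Lefschetz classes is `ω`-odd (two Lefschetz arcs share exactly one branch point). -/
def OddPair (W : Shadow) : Prop := ∃ i j, ω (W.cs i) (W.cs j) = 1

theorem not_oddPair_iff (W : Shadow) : ¬ OddPair W ↔ AllOrthogonal W := by
  constructor
  · intro h i j
    by_contra h1
    have : ω (W.cs i) (W.cs j) = 1 := by
      generalize ω (W.cs i) (W.cs j) = t at h1 ⊢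
      revert t; decide
    exact h ⟨i, j, this⟩
  · rintro h ⟨i, j, h1⟩
    rw [h i j] at h1
    exact zero_ne_one h1

/-- UN-FLIP shape: the four Lefschetz classes are `{u,u,v,v}` for two distinct orthogonal classes each odd against
the round class (BH: arcs `A, A, B, B` with `A ∩ B = ∅`, the round arc joining `A` to `B`). -/
def FlipType (W : Shadow) : Prop :=
  ∃ u v : V, u ≠ v ∧ ω u v = 0 ∧ ω W.c u = 1 ∧ ω W.c v = 1 ∧
    (W.cs = ![u, u, v, v] ∨ W.cs = ![u, v, u, v] ∨ W.cs = ![u, v, v, u] ∨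
     W.cs = ![v, u, u, v] ∨ W.cs = ![v, u, v, u] ∨ W.cs = ![v, v, u, u])

theorem allOrthogonal_of_flipType {W : Shadow} (h : FlipType W) : AllOrthogonal W := by
  obtain ⟨u, v, _, huv, _, _, hcs⟩ := h
  have hvu : ω v u = 0 := by rw [ω_comm]; exact huv
  have huu := ω_self u
  have hvv := ω_self v
  intro i j
  rcases hcs with h | h | h | h | h | h <;>
    · rw [h]; fin_cases i <;> fin_cases j <;> simp [huv, hvu, huu, hvv]

/-- Invariance of all-orthogonality under one elementary transformation (both directions). -/
theorem allOrthogonal_iff_move (i : Fin 3) (W : Shadow) : AllOrthogonal (move i W) ↔ AllOrthogonal W := by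
  constructor
  · intro h
    -- the moved pair is still orthogonal, so the transvection did nothing
    have t0 : ω (W.cs i.succ) (W.cs i.castSucc) = 0 := by
      have := h i.castSucc i.succ
      fin_cases i <;>
        simpa [move, transvection, ω_add_right, ω_smul_right, ω_self] using this
    have key : ∀ j, ∃ k, (move i W).cs j = W.cs k := by
      intro j
      by_cases hj : j = i.castSucc
      · exact ⟨i.succ, by simp [move, hj]⟩
      · by_cases hj' : j = i.succ
        · refine ⟨i.castSucc, ?_⟩
          subst hj'
          simp [move, transvection, t0, hj]
        · exact ⟨j, by simp [move, hj, hj']⟩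
    intro a b
    -- pull back: every original entry is a moved entry
    have back : ∀ k, ∃ j, W.cs k = (move i W).cs j := by
      intro k
      by_cases hk : k = i.succ
      · exact ⟨i.castSucc, by simp [move, hk]⟩
      · by_cases hk' : k = i.castSucc
        · refine ⟨i.succ, ?_⟩
          have hne : (i.succ : Fin 4) ≠ i.castSucc := by
            fin_cases i <;> decide
          simp [move, transvection, t0, hne, hk']
        · exact ⟨k, by simp [move, hk, hk']⟩
    obtain ⟨ja, ha⟩ := back a
    obtain ⟨jb, hb⟩ := back b
    rw [ha, hb]; exact h ja jb
  · intro h a b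
    have t0 : ω (W.cs i.succ) (W.cs i.castSucc) = 0 := h _ _
    simp only [move]
    split_ifs <;> simp [transvection, t0, h _ _]

theorem allOrthogonal_iff_map (g : V → V) (hg : ∀ x y, ω (g x) (g y) = ω x y) (W : Shadow) :
    AllOrthogonal (W.map g) ↔ AllOrthogonal W := by
  simp [AllOrthogonal, Shadow.map, hg]

theorem allOrthogonal_iff_of_equiv {W W' : Shadow} (h : Equiv W W') : AllOrthogonal W ↔ AllOrthogonal W' := by
  induction h with
  | refl W => exact Iff.rfl
  | symm _ ih => exact ih.symm
  | trans _ _ ih₁ ih₂ => exact ih₁.trans ih₂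
  | move i W => exact (allOrthogonal_iff_move i W).symm
  | map g hg W => exact (allOrthogonal_iff_map g hg W).symm

/-- **Dichotomy.** Nothing mod-2-Hurwitz-equivalent to an un-flip position has an `ω`-odd pair of Lefschetz
classes; by `oddPair_of_cusps` every un-wrinkle position has one.  So a Hurwitz class of genus-2 SBLF systems is
never both un-flippable (route SblfDescent's engine, Hayano Thm 5.1) and un-wrinklable (card unwrinkle-to-matsumoto). -/
theorem not_oddPair_of_equiv_flipType {W₀ W : Shadow} (h₀ : FlipType W₀) (h : Equiv W₀ W) : ¬ OddPair W := by
  rw [not_oddPair_iff]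
  exact (allOrthogonal_iff_of_equiv h).mp (allOrthogonal_of_flipType h₀)

/-- UN-FLIP position, shape (a) (`π_φ = 1`, e.g. the flip-and-slip of the genus-1 fibrations of `L_n`, `L₁ = S⁴`,
Hayano arXiv:1711.02790 §4: `e₄ = ψ_n(e₂) ≡ e₂`): Williams circuit `(e₁, e₂, e₃, e₂)` with `e₁·e₂ = e₂·e₃ = 1`,
`e₁·e₃ = 0`, `e₁ ≠ e₃`; Lefschetz classes `t_{e₁}e₂, t_{e₂}e₃, t_{e₃}e₂, t_{e₂}e₁`. -/
theorem flipType_shape_a (e₁ e₂ e₃ : V) (h12 : ω e₁ e₂ = 1) (h23 : ω e₂ e₃ = 1) (h13 : ω e₁ e₃ = 0)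
    (hne : e₁ ≠ e₃) :
    FlipType ⟨e₁, ![transvection e₁ e₂, transvection e₂ e₃, transvection e₃ e₂, transvection e₂ e₁]⟩ := by
  have h21 : ω e₂ e₁ = 1 := by rw [ω_comm]; exact h12
  have h32 : ω e₃ e₂ = 1 := by rw [ω_comm]; exact h23
  refine ⟨e₂ + e₁, e₃ + e₂, ?_, ?_, ?_, ?_, Or.inr (Or.inr (Or.inl ?_))⟩
  · intro h
    apply hne
    have : e₂ + e₁ - e₂ = e₃ + e₂ - e₂ := by rw [h]
    simpa [add_sub_cancel_left] using this
  · simp only [ω_add_left, ω_add_right, ω_self, h12, h21, h23, h13]; decide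
  · rw [ω_add_right, h12, ω_self]; decide
  · rw [ω_add_right, h13, h12]; decide
  · funext j
    fin_cases j <;> simp [transvection, h12, h23, h32, h21, add_comm]

/-- UN-FLIP position, shape (d) (`π_φ = (pq)(st)(uw)`): `e₄ ≡ e₁ + e₂ + e₃`; Lefschetz classes
`t_{e₁}e₂, t_{e₂}e₃, t_{e₃}e₄, t_{e₄}e₁` come out ALTERNATING `u, v, u, v`. -/
theorem flipType_shape_d (e₁ e₂ e₃ : V) (h12 : ω e₁ e₂ = 1) (h23 : ω e₂ e₃ = 1) (h13 : ω e₁ e₃ = 0)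
    (hne : e₁ ≠ e₃) :
    FlipType ⟨e₁, ![transvection e₁ e₂, transvection e₂ e₃, transvection e₃ (e₁ + e₂ + e₃),
      transvection (e₁ + e₂ + e₃) e₁]⟩ := by
  have h21 : ω e₂ e₁ = 1 := by rw [ω_comm]; exact h12
  have h32 : ω e₃ e₂ = 1 := by rw [ω_comm]; exact h23
  have h31 : ω e₃ e₁ = 0 := by rw [ω_comm]; exact h13
  have hA : ω e₃ (e₁ + e₂ + e₃) = 1 := by
    rw [ω_add_right, ω_add_right, h31, h32, ω_self]; decide
  have hB : ω (e₁ + e₂ + e₃) e₁ = 1 := by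
    rw [ω_add_left, ω_add_left, ω_self, h21, h31]; decide
  refine ⟨e₂ + e₁, e₃ + e₂, ?_, ?_, ?_, ?_, Or.inr (Or.inl ?_)⟩
  · intro h
    apply hne
    have : e₂ + e₁ - e₂ = e₃ + e₂ - e₂ := by rw [h]
    simpa [add_sub_cancel_left] using this
  · simp only [ω_add_left, ω_add_right, ω_self, h12, h21, h23, h13]; decide
  · rw [ω_add_right, h12, ω_self]; decide
  · rw [ω_add_right, h13, h12]; decide
  · funext j
    fin_cases j
    · show transvection e₁ e₂ = e₂ + e₁
      rw [transvection, h12, one_smul]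
    · show transvection e₂ e₃ = e₃ + e₂
      rw [transvection, h23, one_smul]
    · show transvection e₃ (e₁ + e₂ + e₃) = e₂ + e₁
      rw [transvection, hA, one_smul, add_assoc, add_self, add_zero, add_comm]
    · show transvection (e₁ + e₂ + e₃) e₁ = e₃ + e₂
      rw [transvection, hB, one_smul, ← add_assoc, ← add_assoc, add_self, zero_add, add_comm]

/-- UN-WRINKLE position: an empty 3-cusped circle has arc classes `x, y, z` pairwise `ω`-odd (cusps); the three
Lefschetz classes unsunk from it, `t_x y, t_y z, t_z x`, are pairwise odd — in particular an odd pair exists. -/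
theorem oddPair_of_cusps (x y z : V) (hxy : ω x y = 1) (hyz : ω y z = 1) (hzx : ω z x = 1) :
    ω (transvection x y) (transvection y z) = 1 := by
  have hxz : ω x z = 1 := by rw [ω_comm]; exact hzx
  simp only [transvection, hxy, hyz, one_smul]
  rw [ω_add_left, ω_add_right, ω_add_right, hyz, ω_self, hxz, hxy]; decide

theorem oddPair_of_unwrinklePosition (c x y z c₄ : V) (hxy : ω x y = 1) (hyz : ω y z = 1) (hzx : ω z x = 1) :
    OddPair ⟨c, ![transvection x y, transvection y z, transvection z x, c₄]⟩ :=
  ⟨0, 1, by simpa using oddPair_of_cusps x y z hxy hyz hzx⟩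

/-! ### Step (4) of Theorem A: the class of `e₄ = φ⁻¹(α̃)`
Normalise (change of coordinates, Sp(4,𝔽₂) ≅ S₆ is transitive on such triples) `c̃ = h₁₂`, `d = h₃₄`, `α̃ = h₂₃`.
Hayano's `φ` (1203.4299 Thm 5.1, condition C₃′ with trivial boundary monodromy) preserves `c̃` and `d` and lies in
`Ker Φ_d ∩ Ker Φ_c̃`, so mod 2 it is an `ω`-isometry inducing the identity on `d^⊥/⟨d⟩` and on `c̃^⊥/⟨c̃⟩`.
CONCLUSION: `φ̄(α̃) ∈ {α̃, α̃ + d + c̃}` = `{h₂₃, h₁₄}` — shapes (a) and (d); the mixed classes `h₂₄, h₁₃` do not occur. -/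

section StepFour

private def Cst : V := ![1, 0, 0, 0]   -- c̃ = h₁₂ = a₁
private def Dst : V := ![1, 0, 1, 0]   -- d  = h₃₄ = a₁ + a₂
private def Yst : V := ![0, 1, 0, 0]   -- α̃ = h₂₃ = b₁
private def Ast : V := ![1, 1, 1, 1]   -- h₂₅ ∈ d^⊥
private def Bst : V := ![1, 0, 1, 1]   -- h₃₅ ∈ c̃^⊥,  α̃ = h₂₅ + h₃₅

theorem e4_class_dichotomy (φ : V → V) (hadd : ∀ x y, φ (x + y) = φ x + φ y)
    (hω : ∀ x y, ω (φ x) (φ y) = ω x y)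
    (hd : ∀ x, ω x Dst = 0 → φ x = x ∨ φ x = x + Dst)
    (hc : ∀ x, ω x Cst = 0 → φ x = x ∨ φ x = x + Cst) :
    φ Yst = Yst ∨ φ Yst = Yst + Dst + Cst := by
  have ha := hd Ast (by decide)
  have hb := hc Bst (by decide)
  have hY : Yst = Ast + Bst := by decide
  have hab := hω Ast Bst
  rw [hY, hadd]
  rcases ha with ha | ha <;> rcases hb with hb | hb <;> rw [ha, hb] at hab ⊢
  · left; rfl
  · exact absurd hab (by decide)
  · exact absurd hab (by decide)
  · right; decide

end StepFour

/-! ### The census representatives and the two known S⁴ systems, sorted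
BH dictionary mod 2 (chain `c_k ↔` arc `(k,k+1)`): `h₁₂ = a₁, h₂₃ = b₁, h₃₄ = a₁+a₂, h₄₅ = b₂, h₅₆ = a₂`,
`h_{ij} = Σ_{i ≤ k < j} h_{k,k+1}`.  Round curve `c = x₁x₂ ↔ h₁₂`. -/

def a₁ : V := ![1, 0, 0, 0]
def b₁ : V := ![0, 1, 0, 0]
def a₂ : V := ![0, 0, 1, 0]
def b₂ : V := ![0, 0, 0, 1]
/-- class of the BH arc `{i,j}` (1 ≤ i < j ≤ 6). -/
def h (i j : ℕ) : V :=
  (if i ≤ 1 ∧ 1 < j then a₁ else 0) + (if i ≤ 2 ∧ 2 < j then b₁ else 0) +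
  (if i ≤ 3 ∧ 3 < j then a₁ + a₂ else 0) + (if i ≤ 4 ∧ 4 < j then b₂ else 0) +
  (if i ≤ 5 ∧ 5 < j then a₂ else 0)

/-- F = flip-and-slip of the genus-1 fibration of `L_n ⊇ {S⁴ = L₁}` (shape (a) on the chain `c₁,c₂,c₃`):
arcs `{1,3},{2,4},{2,4},{1,3}`. FLIP-TYPE. -/
example : FlipType ⟨h 1 2, ![h 1 3, h 2 4, h 2 4, h 1 3]⟩ :=
  ⟨h 1 3, h 2 4, by decide, by decide, by decide, by decide, by decide⟩
/-- Hayano–Sato `W₂'` on `S⁴` (g38 normalisation): arcs `{1,3},{1,3},{2,6},{2,6}`. FLIP-TYPE. -/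
example : FlipType ⟨h 1 2, ![h 1 3, h 1 3, h 2 6, h 2 6]⟩ :=
  ⟨h 1 3, h 2 6, by decide, by decide, by decide, by decide, by decide⟩
/-- g38 comp0 (917 data): arcs `{1,5},{2,4},{1,5},{2,4}`. FLIP-TYPE (alternating, shape (d)). -/
example : FlipType ⟨h 1 2, ![h 1 5, h 2 4, h 1 5, h 2 4]⟩ :=
  ⟨h 1 5, h 2 4, by decide, by decide, by decide, by decide, by decide⟩
/-- g38 comp2 (272): arcs `{2,5},{2,5},{1,4},{1,4}`. FLIP-TYPE. -/
example : FlipType ⟨h 1 2, ![h 2 5, h 2 5, h 1 4, h 1 4]⟩ :=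
  ⟨h 2 5, h 1 4, by decide, by decide, by decide, by decide, by decide⟩
/-- g38 comp1 (856, P = [3,1,1,1]): arcs `{2,5},{2,5},{2,3},{2,3}`. ODD PAIR ⇒ never un-flippable. -/
example : OddPair ⟨h 1 2, ![h 2 5, h 2 5, h 2 3, h 2 3]⟩ := ⟨0, 2, by decide⟩
/-- g38 comp3 (272, P = [3,1,1,1]): arcs `{1,5},{1,5},{1,4},{1,4}`. ODD PAIR. -/
example : OddPair ⟨h 1 2, ![h 1 5, h 1 5, h 1 4, h 1 4]⟩ := ⟨0, 2, by decide⟩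
/-- g38 comp4 (143, P = [3,1,1,1]): arcs `{1,4},{3,4},{1,4},{1,3}`. ODD PAIR. -/
example : OddPair ⟨h 1 2, ![h 1 4, h 3 4, h 1 4, h 1 3]⟩ := ⟨0, 1, by decide⟩
/-- g38 comp5 (96, P = [3,2,1]): arcs `{4,5},{1,6},{3,6},{1,3}`. ODD PAIR. -/
example : OddPair ⟨h 1 2, ![h 4 5, h 1 6, h 3 6, h 1 3]⟩ := ⟨1, 2, by decide⟩

end Summit.SmoothPoincare4.SmoothPoincare4.Cruxes.StepTwo.Mod2Sorting
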